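import Mathlib.LinearAlgebra.Matrix.Charpoly.Coeff
import Mathlib.FieldTheory.IsAlgClosed.Basic
import Mathlib.RingTheory.Henselian
import Mathlib.LinearAlgebra.Lagrange
import Mathlib.LinearAlgebra.SymplecticGroup
import HarnessLib

/-!
# Elements of `Sp(J)` or `O(J)` conjugate in `GL` are conjugate in `Sp(J)` resp. `O(J)` over an
# algebraically closed field; similitudes are conjugate iff they have the same multiplier and are
# `GL`-conjugate (Kottwitz 1992, Lemma 7.1, Cases C and D; Springer–Steinberg IV)

Topic `LinearAlgebra/Matrix`, namespace `Literature.LinearAlgebra.Matrix.IsometryConjugacy` (lane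
`lit-hodgefound`, Track 2 foundations; seat `lit-hodgefound-p11`, generation 32, row g32-#1).  THEOREMS ONLY
(D-0026): no definition, no named fact, no instance, no notation.

## The print, verbatim

R. E. Kottwitz, *Points on some Shimura varieties over finite fields*, J. Amer. Math. Soc. **5** (1992)
373–444 [Kottwitz1992], §7 p. 395 (held text `paper:doi-10-2307-2152772`, p0022 L44–L46, p0023 L1–L19):

«We will also need to understand conjugacy classes in `G(K)`, where `K` is an algebraically closed field
containing `ℚ`. For this we consider the obvious embedding `i : G ↪ H`, where `H` denotes the `ℚ`-group `C^×`
(recall that `C = End_B(V)`), as well as the homomorphism `c : G → 𝔾_m` that associates to `g ∈ G(K)` the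
scalar `c(g) ∈ K^×` such that `(gv, gw) = c(v, w)` for all `v, w ∈ V`.

**Lemma 7.1.** Two elements `x, y` of `G(K)` are conjugate if and only if `c(x) = c(y)` and `i(x)`, `i(y)`
are conjugate in `H(K)`.

Suppose that `c(x) = c(y)` and that `i(x)`, `i(y)` are conjugate in `H(K)`. We want to show that `x, y` are
conjugate. Modifying `x, y` by the same scalar, we may assume that `c(x) = c(y) = 1`, so that
`x, y ∈ G₁(K)`. Over `K` the groups `G₁` and `H` decompose as products of factors indexed by the embeddings
of `F₀` in `K`. Thus we may reduce to the case in which `G₁ ↪ H` is of one of the three following types: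
(A) `GL_n ↪ GL_n × GL_n` (diagonal map), (C) `Sp_{2n} ↪ GL_{2n}`, (D) `O_{2n} ↪ GL_{2n}`.
Case A is trivial and Cases C and D are dealt with in the fourth chapter of the article by Springer and
Steinberg in [B] (for semisimple `x, y` one can simply look at Weyl group orbits on maximal tori of the
groups `G₁` and `H`).»

(`[B]` = A. Borel et al., *Seminar on algebraic groups and related finite groups*, LNM 131; the fourth chapter
of T. A. Springer, R. Steinberg, *Conjugacy classes* [SpringerSteinberg1970] treats the classical groups;
that text is not held — acq-13674 — and is cited here only through Kottwitz's pointer.)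

## What is formalised (points over a field `K`; one factor of Case C / D, i.e. one form `J`)

Throughout, `J : Matrix n n K` is a form with `det J` a unit and `Jᵀ = ε J`, `ε² = 1` (`ε = -1`:
alternating, Case C, `G₁ = Sp(J)`; `ε = 1`: symmetric, Case D, `G₁ = O(J)`); an isometry is a matrix `x`
with `xᵀ J x = J`, a similitude one with `xᵀ J x = c J`, `c = c(x)` its multiplier; "conjugate in `H(K)`"
= "`g x = y g` for some `g` with `det g` a unit".  The proof formalised is the standard algebraic one
(valid for `K` algebraically closed of characteristic `≠ 2`; Kottwitz's `K ⊇ ℚ` is the case `char K = 0`):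
if `g x g⁻¹ = y` with `x, y ∈ G₁(K)` then `s = J⁻¹ gᵀ J g` commutes with `x` and is self-adjoint
(`sᵀ J = J s`); an invertible matrix over `K` has a square root `h = p(s)` which is a POLYNOMIAL in `s`
(§1, by a Hensel lift in `K[X]/(charpoly s)` — the method of the tree's
`LinearAlgebra/Matrix/MatrixSquareRootExercise` over `ℂ`, redone over any field for split characteristic
polynomials whose roots are squares), hence `h` commutes with `x` and is self-adjoint, and then
`k = g h⁻¹` is an isometry of `J` with `k x k⁻¹ = g x g⁻¹ = y`.

* §1 **`exists_dvd_sq_sub_X`** (`m` monic split, `m(0) ≠ 0`, every root a square, `2 ≠ 0`: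
  `∃ p, m ∣ p² − X`), **`exists_aeval_sq_eq`** (`det A` a unit, `charpoly A` split with square roots:
  `∃ p, p(A)² = A`), **`exists_aeval_sq_eq_of_isAlgClosed`**.
* §2 `transpose_aeval` (`p(s)ᵀ = p(sᵀ)`), `commute_aeval_of_commute`, `transpose_aeval_mul_eq_mul_aeval`
  (`sᵀ J = J s ⇒ p(s)ᵀ J = J p(s)`), `isUnit_det_of_similitude`, **`commute_of_isometry_conj`**
  (`x, y ∈ G₁`, `g x = y g` ⇒ `x` commutes with `J⁻¹ gᵀ J g`), **`commute_of_skewAdjoint_conj`** (the same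
  for `X, Y ∈ Lie G₁`: `Xᵀ J = −J X`), `transpose_adjointProduct_mul` (`s = J⁻¹ gᵀ J g` is self-adjoint),
  the engine **`exists_isometry_conj_eq_conj_of_commute`** (`x` commutes with `J⁻¹ gᵀ J g` ⇒ some isometry
  `k` has `k x k⁻¹ = g x g⁻¹`), and the theorems **`exists_isometry_conj_of_conj`** /
  **`exists_isometry_conj_iff`** (Cases C, D of Lemma 7.1 with `c = 1`: `x, y ∈ G₁(K)` are `G₁(K)`-conjugate
  iff `GL`-conjugate), `exists_gl_isometry_conj_iff` (the same inside `GL n K`),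
  **`exists_isometry_conj_of_conj_lie`** (Lie-algebra version), **`symplecticGroup_exists_conj_iff`**
  (Mathlib's `Matrix.symplecticGroup`), **`orthogonal_exists_conj_iff`** (`J = 1`).
* §3 **`multiplier_of_conj`** (a similitude conjugate of a similitude of multiplier `c` has multiplier `c`:
  the "only if" of Lemma 7.1), `eq_of_smul_eq_smul`, **`exists_isometry_conj_of_multiplier_eq`** («modifying
  `x, y` by the same scalar we may assume `c(x) = c(y) = 1`»: same multiplier + `GL`-conjugate ⇒ conjugate by
  an ISOMETRY), **`exists_similitude_conj_iff`** (Lemma 7.1 for one factor of type C or D: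
  `x ~ y` in `G(K)` iff `c(x) = c(y)` and `x ~ y` in `GL`), and Case A **`isConj_prod_diag_iff`**
  (`(x, x) ~ (y, y)` in `M × M` iff `x ~ y` in `M` — «Case A is trivial»).

Not formalised: the reduction of `G(K)` to the product of its simple factors (Morita / embeddings of `F₀`),
nor the semisimple shortcut via Weyl-group orbits.  Bridge to the tree's automorphic files: for
`x : GL n K`, `x ∈ unitaryGroupOfForm (RingHom.id K) J ↔ (x : Matrix n n K)ᵀ * J * x = J`
(`Automorphic.SymplecticSimilitude.mem_unitaryGroupOfForm_id_iff` for `J = Matrix.J`), so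
`exists_gl_isometry_conj_iff` is the statement for `U(id, J)(K) = Sp(J)(K)` resp. `O(J)(K)`.

## References

* [Kottwitz1992] R. E. Kottwitz, *Points on some Shimura varieties over finite fields*, J. Amer. Math. Soc. 5
  (1992), §7 Lemma 7.1, p. 395.
* [SpringerSteinberg1970] T. A. Springer, R. Steinberg, *Conjugacy classes*, in: Seminar on Algebraic Groups
  and Related Finite Groups, LNM 131 (1970), Part E, Ch. IV (cited through Kottwitz; not held, acq-13674).
-/

open Matrix Polynomial

namespace Literature.LinearAlgebra.Matrix.IsometryConjugacy

variable {K : Type*} [Field K]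

/-! ## §1 Polynomial square roots of invertible matrices -/

section SquareRoot

/-- A ring is adically complete with respect to a nilpotent ideal (Cauchy completeness and the Hausdorff
property are immediate from `I ^ N = 0`; the same helper as in `MatrixSquareRootExercise`). [folklore] -/
private theorem isAdicComplete_of_pow_eq_bot {R : Type*} [CommRing R] {I : Ideal R} {N : ℕ}
    (hN : I ^ N = ⊥) : IsAdicComplete I R where
  haus' := by
    intro x hx
    have h := hx N
    rw [SModEq.zero, smul_eq_mul, Ideal.mul_top, hN] at h
    simpa using h
  prec' := by
    intro f hf
    refine ⟨f N, fun k => ?_⟩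
    rcases le_total k N with h | h
    · exact hf h
    · have h2 : f N ≡ f k [SMOD (I ^ N • ⊤ : Submodule R R)] := hf h
      rw [SModEq.sub_mem, smul_eq_mul, Ideal.mul_top, hN, Ideal.mem_bot, sub_eq_zero] at h2
      rw [h2]

/-- **Square roots modulo a split polynomial.**  Let `2 ≠ 0` in the field `K` and let `m ∈ K[X]` be monic
and split with `m(0) ≠ 0`, every root of `m` being a square in `K`.  Then `X` is a square modulo `m`:
`m ∣ p² − X` for some `p ∈ K[X]`.  (Proof: with `Λ` the set of roots and `rad = ∏_{μ ∈ Λ} (X − μ)`, the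
Lagrange interpolant `q` with `q(μ) = √μ` has `rad ∣ q² − X`; in `K[X]/(m)` the ideal `(rad)` is
nilpotent, so the quotient is `(rad)`-adically complete, hence Henselian, and the simple root `q̄` of
`T² − X̄` lifts.)  This is the algebra behind «Cases C and D» of Lemma 7.1 (a square root of `gᵀ J g · J⁻¹`
which is a polynomial in it). [cite: Kottwitz1992, §7 Lemma 7.1 p. 395] -/
theorem exists_dvd_sq_sub_X (h2 : (2 : K) ≠ 0) {m : K[X]} (hmo : m.Monic) (hsplit : m.Splits)
    (h0 : m.eval 0 ≠ 0) (hsq : ∀ μ ∈ m.roots, ∃ z : K, z ^ 2 = μ) :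
    ∃ p : K[X], m ∣ p ^ 2 - X := by
  classical
  set s : Multiset K := m.roots with hs_def
  set Λ : Finset K := s.toFinset with hΛ_def
  have hm_prod : m = ∏ μ ∈ Λ, (X - C μ) ^ s.count μ := by
    conv_lhs => rw [hsplit.eq_prod_roots_of_monic hmo]
    rw [Finset.prod_multiset_map_count]
  -- `0` is not a root
  have h0Λ : (0 : K) ∉ Λ := by
    intro h
    rw [hΛ_def, Multiset.mem_toFinset, hs_def, mem_roots hmo.ne_zero, IsRoot] at h
    exact h0 h
  -- square roots of the roots and their Lagrange interpolant `q`
  have hsq' : ∀ μ : K, ∃ z : K, μ ∈ Λ → z ^ 2 = μ := by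
    intro μ
    by_cases hμ : μ ∈ Λ
    · obtain ⟨z, hz⟩ := hsq μ (by rwa [hΛ_def, Multiset.mem_toFinset] at hμ)
      exact ⟨z, fun _ => hz⟩
    · exact ⟨0, fun h => (hμ h).elim⟩
  choose sq hsqΛ using hsq'
  have hsq0 : ∀ μ ∈ Λ, sq μ ≠ 0 := by
    intro μ hμ h
    apply h0Λ
    have hz := hsqΛ μ hμ
    rw [h, zero_pow two_ne_zero] at hz
    rwa [← hz] at hμ
  set q : K[X] := Lagrange.interpolate Λ id sq with hq_def
  have hq_eval : ∀ μ ∈ Λ, q.eval μ = sq μ := fun μ hμ =>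
    Lagrange.eval_interpolate_at_node sq (Set.injOn_id _) hμ
  -- the radical `rad` of `m`
  set rad : K[X] := ∏ μ ∈ Λ, (X - C μ) with hrad_def
  have hcop : (↑Λ : Set K).Pairwise (Function.onFun IsCoprime fun μ : K => X - C μ) :=
    fun μ _ ν _ hne => isCoprime_X_sub_C_of_isUnit_sub (sub_ne_zero.mpr hne).isUnit
  have hrad_dvd : rad ∣ q ^ 2 - X := by
    refine Finset.prod_dvd_of_coprime hcop fun μ hμ => ?_
    rw [dvd_iff_isRoot, IsRoot, eval_sub, eval_pow, eval_X, hq_eval μ hμ, hsqΛ μ hμ, sub_self]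
  set N : ℕ := Multiset.card s with hN_def
  have hm_dvd : m ∣ rad ^ N := by
    rw [hm_prod, hrad_def, ← Finset.prod_pow]
    exact Finset.prod_dvd_prod_of_dvd _ _ fun μ _ => pow_dvd_pow _ (Multiset.count_le_card μ s)
  have hqm : IsCoprime q m := by
    rw [hm_prod]
    refine IsCoprime.prod_right fun μ hμ => IsCoprime.pow_right ?_
    refine ((irreducible_X_sub_C μ).coprime_iff_not_dvd.mpr fun hd => ?_).symm
    rw [dvd_iff_isRoot, IsRoot, hq_eval μ hμ] at hd
    exact hsq0 μ hμ hd
  -- the quotient ring `Q = K[X]/(m)` and its nilpotent ideal `I = (rad)`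
  set I₀ : Ideal K[X] := Ideal.span {m} with hI₀_def
  set mk : K[X] →+* K[X] ⧸ I₀ := Ideal.Quotient.mk I₀ with hmk_def
  set I : Ideal (K[X] ⧸ I₀) := Ideal.span {mk rad} with hI_def
  have hIN : I ^ N = ⊥ := by
    rw [hI_def, Ideal.span_singleton_pow, Ideal.span_singleton_eq_bot, ← map_pow,
      hmk_def, Ideal.Quotient.eq_zero_iff_mem, hI₀_def, Ideal.mem_span_singleton]
    exact hm_dvd
  haveI : IsAdicComplete I (K[X] ⧸ I₀) := isAdicComplete_of_pow_eq_bot hIN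
  -- Hensel: lift the simple root `mk q` of `T² - mk X` modulo `I`
  set f : (K[X] ⧸ I₀)[X] := X ^ 2 - C (mk X) with hf_def
  have hf_monic : f.Monic := monic_X_pow_sub_C (mk X) two_ne_zero
  have hf_eval : f.eval (mk q) ∈ I := by
    obtain ⟨w, hw⟩ := hrad_dvd
    rw [hf_def, eval_sub, eval_pow, eval_X, eval_C, ← map_pow, ← map_sub, hw, map_mul, hI_def]
    exact Ideal.mem_span_singleton'.mpr ⟨mk w, by ring⟩
  have hunit_q : IsUnit (mk q) := by
    obtain ⟨u, v, huv⟩ := hqm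
    have hm0 : mk m = 0 := by
      rw [hmk_def, Ideal.Quotient.eq_zero_iff_mem, hI₀_def]
      exact Ideal.mem_span_singleton_self m
    have h1 : mk u * mk q = 1 := by
      have h2' : mk (u * q + v * m) = 1 := by rw [huv, map_one]
      rw [map_add, map_mul, map_mul, hm0, mul_zero, add_zero] at h2'
      exact h2'
    exact IsUnit.of_mul_eq_one_right _ h1
  have hunit_two : IsUnit (2 : K[X] ⧸ I₀) := by
    have h2u : IsUnit ((algebraMap K (K[X] ⧸ I₀)) 2) := (isUnit_iff_ne_zero.mpr h2).map _
    rwa [map_ofNat] at h2u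
  have hf_deriv : IsUnit (Ideal.Quotient.mk I (f.derivative.eval (mk q))) := by
    refine IsUnit.map _ ?_
    have hd : f.derivative.eval (mk q) = 2 * mk q := by
      rw [hf_def, derivative_sub, derivative_X_pow, derivative_C, sub_zero, eval_mul, eval_C,
        eval_pow, eval_X]
      norm_num
    rw [hd]
    exact hunit_two.mul hunit_q
  obtain ⟨b, hb, -⟩ := HenselianRing.is_henselian (I := I) f hf_monic (mk q) hf_eval hf_deriv
  -- back to polynomials: `m ∣ p² - X`
  obtain ⟨p, rfl⟩ := Ideal.Quotient.mk_surjective b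
  refine ⟨p, ?_⟩
  rw [IsRoot, hf_def, eval_sub, eval_pow, eval_X, eval_C, ← hmk_def, ← map_pow, ← map_sub,
    hmk_def, Ideal.Quotient.eq_zero_iff_mem, hI₀_def, Ideal.mem_span_singleton] at hb
  exact hb

variable {n : Type*} [Fintype n] [DecidableEq n]

/-- **An invertible matrix with split characteristic polynomial whose eigenvalues are squares has a square
root which is a polynomial in it** (`2 ≠ 0`): `p(A)² = A` (Cayley–Hamilton transports `charpoly A ∣ p² − X`).
[cite: Kottwitz1992, §7 Lemma 7.1 p. 395] -/
theorem exists_aeval_sq_eq (h2 : (2 : K) ≠ 0) {A : Matrix n n K} (hA : IsUnit A.det)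
    (hsplit : A.charpoly.Splits) (hsq : ∀ μ ∈ A.charpoly.roots, ∃ z : K, z ^ 2 = μ) :
    ∃ p : K[X], (aeval A p) ^ 2 = A := by
  have h0 : A.charpoly.eval 0 ≠ 0 := by
    rw [← coeff_zero_eq_eval_zero]
    intro h
    apply hA.ne_zero
    rw [Matrix.det_eq_sign_charpoly_coeff, h, mul_zero]
  obtain ⟨p, w, hw⟩ := exists_dvd_sq_sub_X h2 (Matrix.charpoly_monic A) hsplit h0 hsq
  refine ⟨p, ?_⟩
  have h := congrArg (aeval A) hw
  rw [map_sub, map_pow, aeval_X, map_mul, Matrix.aeval_self_charpoly, zero_mul, sub_eq_zero] at h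
  exact h

/-- **Over an algebraically closed field with `2 ≠ 0` every invertible matrix has a square root which is
a polynomial in it.** [cite: Kottwitz1992, §7 Lemma 7.1 p. 395] -/
theorem exists_aeval_sq_eq_of_isAlgClosed [IsAlgClosed K] (h2 : (2 : K) ≠ 0) {A : Matrix n n K}
    (hA : IsUnit A.det) : ∃ p : K[X], (aeval A p) ^ 2 = A :=
  exists_aeval_sq_eq h2 hA (IsAlgClosed.splits _) fun μ _ => IsAlgClosed.exists_pow_nat_eq μ two_pos

end SquareRoot

/-! ## §2 Isometries of `J` conjugate in `GL` are conjugate by an isometry -/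

section Isometry

variable {n : Type*} [Fintype n] [DecidableEq n]

/-- `p(s)ᵀ = p(sᵀ)`. [folklore] -/
private theorem transpose_aeval (s : Matrix n n K) (p : K[X]) : (aeval s p)ᵀ = aeval sᵀ p := by
  induction p using Polynomial.induction_on' with
  | add p q hp hq => rw [map_add, map_add, transpose_add, hp, hq]
  | monomial k c =>
    rw [aeval_monomial, aeval_monomial, transpose_mul, transpose_pow, Algebra.algebraMap_eq_smul_one,
      transpose_smul, transpose_one, Matrix.mul_smul, Matrix.smul_mul, Matrix.mul_one, Matrix.one_mul]

/-- A polynomial in `s` commutes with whatever commutes with `s`. [folklore] -/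
private theorem commute_aeval_of_commute {x s : Matrix n n K} (h : Commute x s) (p : K[X]) :
    Commute x (aeval s p) := by
  induction p using Polynomial.induction_on' with
  | add p q hp hq => rw [map_add]; exact hp.add_right hq
  | monomial k c =>
    rw [aeval_monomial]
    exact (Algebra.commute_algebraMap_right c x).mul_right (h.pow_right k)

/-- Self-adjointness for `J` passes to polynomials: `sᵀ J = J s ⇒ p(s)ᵀ J = J p(s)`. [folklore] -/
private theorem transpose_aeval_mul_eq_mul_aeval {J s : Matrix n n K} (h : sᵀ * J = J * s) (p : K[X]) :
    (aeval s p)ᵀ * J = J * aeval s p := by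
  rw [transpose_aeval]
  have hsc : SemiconjBy J s sᵀ := h.symm
  induction p using Polynomial.induction_on' with
  | add p q hp hq => rw [map_add, map_add, Matrix.add_mul, Matrix.mul_add, hp, hq]
  | monomial k c =>
    rw [aeval_monomial, aeval_monomial, mul_assoc, ← (hsc.pow_right k).eq, ← mul_assoc,
      Algebra.commutes c J, mul_assoc]

/-- **A similitude of a form with unit determinant is invertible**: `xᵀ J x = c J`, `det J` and `c` units
⇒ `det x` a unit (`(det x)² det J = cⁿ det J`). [cite: Kottwitz1992, §7 Lemma 7.1 p. 395] -/
theorem isUnit_det_of_similitude {J x : Matrix n n K} {c : K} (hJ : IsUnit J.det) (hc : IsUnit c)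
    (hx : xᵀ * J * x = c • J) : IsUnit x.det := by
  have h := congrArg Matrix.det hx
  rw [det_mul, det_mul, det_transpose, det_smul] at h
  have h' : x.det * x.det * J.det = c ^ Fintype.card n * J.det := by linear_combination h
  have h'' : x.det * x.det = c ^ Fintype.card n := hJ.mul_left_inj.1 h'
  exact isUnit_of_mul_isUnit_left (by rw [h'']; exact hc.pow _)

/-- An isometry of a form with unit determinant is invertible. [cite: Kottwitz1992, §7 Lemma 7.1 p. 395] -/
theorem isUnit_det_of_isometry {J x : Matrix n n K} (hJ : IsUnit J.det) (hx : xᵀ * J * x = J) :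
    IsUnit x.det :=
  isUnit_det_of_similitude hJ isUnit_one (by rw [hx, one_smul])

/-- **The commuting element (group case).**  If `x, y` are isometries of `J` (`xᵀ J x = J = yᵀ J y`) and
`g x = y g`, then `M = gᵀ J g` is a second form preserved by `x` (`xᵀ M x = M`), hence
`s = J⁻¹ gᵀ J g` commutes with `x`. [cite: Kottwitz1992, §7 Lemma 7.1 p. 395] -/
theorem commute_of_isometry_conj {J x y g : Matrix n n K} (hJ : IsUnit J.det)
    (hx : xᵀ * J * x = J) (hy : yᵀ * J * y = J) (hxy : g * x = y * g) :
    Commute x (J⁻¹ * gᵀ * J * g) := by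
  have hM : xᵀ * (gᵀ * J * g) * x = gᵀ * J * g := by
    calc xᵀ * (gᵀ * J * g) * x = (g * x)ᵀ * J * (g * x) := by
          rw [transpose_mul]; simp only [mul_assoc]
      _ = (y * g)ᵀ * J * (y * g) := by rw [hxy]
      _ = gᵀ * (yᵀ * J * y) * g := by rw [transpose_mul]; simp only [mul_assoc]
      _ = gᵀ * J * g := by rw [hy]
  have hxdet : IsUnit x.det := isUnit_det_of_isometry hJ hx
  have hu : IsUnit (xᵀ * J) :=
    (Matrix.isUnit_iff_isUnit_det _).mpr (by rw [det_mul, det_transpose]; exact hxdet.mul hJ)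
  refine hu.mul_right_injective (?_ : xᵀ * J * (x * (J⁻¹ * gᵀ * J * g)) =
    xᵀ * J * (J⁻¹ * gᵀ * J * g * x))
  calc xᵀ * J * (x * (J⁻¹ * gᵀ * J * g))
      = xᵀ * J * x * (J⁻¹ * gᵀ * J * g) := by simp only [mul_assoc]
    _ = J * J⁻¹ * (gᵀ * J * g) := by rw [hx]; simp only [mul_assoc]
    _ = gᵀ * J * g := by rw [mul_nonsing_inv J hJ, one_mul]
    _ = xᵀ * (gᵀ * J * g) * x := hM.symm
    _ = xᵀ * (J * J⁻¹) * (gᵀ * J * g) * x := by rw [mul_nonsing_inv J hJ, mul_one]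
    _ = xᵀ * J * (J⁻¹ * gᵀ * J * g * x) := by simp only [mul_assoc]

/-- **The commuting element (Lie-algebra case).**  If `X, Y ∈ Lie G₁` (`Xᵀ J = −J X`, `Yᵀ J = −J Y`) and
`g X = Y g`, then `s = J⁻¹ gᵀ J g` commutes with `X` (`Xᵀ M = −M X` for `M = gᵀ J g`).
[cite: Kottwitz1992, §7 Lemma 7.1 p. 395] -/
theorem commute_of_skewAdjoint_conj {J X Y g : Matrix n n K} (hJ : IsUnit J.det)
    (hX : Xᵀ * J = -(J * X)) (hY : Yᵀ * J = -(J * Y)) (hXY : g * X = Y * g) :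
    Commute X (J⁻¹ * gᵀ * J * g) := by
  have hM : Xᵀ * (gᵀ * J * g) = -(gᵀ * J * g * X) := by
    calc Xᵀ * (gᵀ * J * g) = (g * X)ᵀ * J * g := by rw [transpose_mul]; simp only [mul_assoc]
      _ = (Y * g)ᵀ * J * g := by rw [hXY]
      _ = gᵀ * (Yᵀ * J) * g := by rw [transpose_mul]; simp only [mul_assoc]
      _ = -(gᵀ * J * (Y * g)) := by rw [hY, Matrix.mul_neg, Matrix.neg_mul]; simp only [mul_assoc]
      _ = -(gᵀ * J * g * X) := by rw [← hXY]; simp only [mul_assoc]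
  have hu : IsUnit J := (Matrix.isUnit_iff_isUnit_det _).mpr hJ
  refine hu.mul_right_injective (?_ : J * (X * (J⁻¹ * gᵀ * J * g)) = J * (J⁻¹ * gᵀ * J * g * X))
  have hJX : J * X = -(Xᵀ * J) := by rw [hX, neg_neg]
  calc J * (X * (J⁻¹ * gᵀ * J * g))
      = J * X * J⁻¹ * (gᵀ * J * g) := by simp only [mul_assoc]
    _ = -(Xᵀ * (J * J⁻¹) * (gᵀ * J * g)) := by
        rw [hJX, Matrix.neg_mul, Matrix.neg_mul]; simp only [mul_assoc]
    _ = gᵀ * J * g * X := by rw [mul_nonsing_inv J hJ, mul_one, hM, neg_neg]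
    _ = J * J⁻¹ * (gᵀ * J * g) * X := by rw [mul_nonsing_inv J hJ, one_mul]
    _ = J * (J⁻¹ * gᵀ * J * g * X) := by simp only [mul_assoc]

/-- **`s = J⁻¹ gᵀ J g` is self-adjoint for `J`** (`sᵀ J = J s = gᵀ J g`) when `Jᵀ = ε J`, `ε² = 1`.
[cite: Kottwitz1992, §7 Lemma 7.1 p. 395] -/
theorem transpose_adjointProduct_mul {J g : Matrix n n K} (hJ : IsUnit J.det) {ε : K}
    (hε : ε * ε = 1) (hJt : Jᵀ = ε • J) :
    (J⁻¹ * gᵀ * J * g)ᵀ * J = J * (J⁻¹ * gᵀ * J * g) := by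
  have hinvT : J⁻¹ᵀ = ε • J⁻¹ := by
    rw [transpose_nonsing_inv, hJt]
    refine Matrix.inv_eq_right_inv ?_
    rw [Matrix.smul_mul, Matrix.mul_smul, smul_smul, hε, one_smul, mul_nonsing_inv J hJ]
  calc (J⁻¹ * gᵀ * J * g)ᵀ * J = gᵀ * Jᵀ * g * J⁻¹ᵀ * J := by
        rw [transpose_mul, transpose_mul, transpose_mul, transpose_transpose]; simp only [mul_assoc]
    _ = (ε * ε) • (gᵀ * J * g * (J⁻¹ * J)) := by
        rw [hJt, hinvT]
        simp only [Matrix.mul_smul, Matrix.smul_mul, smul_smul, mul_assoc]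
    _ = gᵀ * J * g := by rw [hε, one_smul, nonsing_inv_mul J hJ, mul_one]
    _ = J * (J⁻¹ * gᵀ * J * g) := by
        rw [← mul_assoc, ← mul_assoc, ← mul_assoc, mul_nonsing_inv J hJ, one_mul]

/-- **The engine** (the square-root argument for Cases C and D): let `K` be algebraically closed with
`2 ≠ 0`, `Jᵀ = ε J` with `ε² = 1` and `det J` a unit, `g` invertible, and suppose `x` commutes with
`s = J⁻¹ gᵀ J g`.  Then some isometry `k` of `J` (namely `k = g h⁻¹` with `h = p(s)`, `h² = s`) satisfies
`k x k⁻¹ = g x g⁻¹`. [cite: Kottwitz1992, §7 Lemma 7.1 p. 395] -/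
theorem exists_isometry_conj_eq_conj_of_commute [IsAlgClosed K] (h2 : (2 : K) ≠ 0) {J : Matrix n n K}
    (hJ : IsUnit J.det) {ε : K} (hε : ε * ε = 1) (hJt : Jᵀ = ε • J) {x g : Matrix n n K}
    (hg : IsUnit g.det) (hc : Commute x (J⁻¹ * gᵀ * J * g)) :
    ∃ k : Matrix n n K, IsUnit k.det ∧ kᵀ * J * k = J ∧ k * x * k⁻¹ = g * x * g⁻¹ := by
  set s : Matrix n n K := J⁻¹ * gᵀ * J * g with hs_def
  have hsdet : IsUnit s.det := by
    rw [hs_def, det_mul, det_mul, det_mul, det_transpose]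
    exact (((Matrix.isUnit_nonsing_inv_det J hJ).mul hg).mul hJ).mul hg
  obtain ⟨p, hp⟩ := exists_aeval_sq_eq_of_isAlgClosed h2 hsdet
  set h : Matrix n n K := aeval s p with hh_def
  have hhx : Commute x h := commute_aeval_of_commute hc p
  have hsadj : sᵀ * J = J * s := transpose_adjointProduct_mul hJ hε hJt
  have hhadj : hᵀ * J = J * h := transpose_aeval_mul_eq_mul_aeval hsadj p
  have hhdet : IsUnit h.det := by
    have h2det : IsUnit (h ^ 2).det := by rw [hp]; exact hsdet
    rw [det_pow] at h2det
    exact (isUnit_pow_iff two_ne_zero).mp h2det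
  have hM : gᵀ * J * g = J * s := by
    rw [hs_def, ← mul_assoc, ← mul_assoc, ← mul_assoc, mul_nonsing_inv J hJ, one_mul]
  refine ⟨g * h⁻¹, ?_, ?_, ?_⟩
  · rw [det_mul]; exact hg.mul (Matrix.isUnit_nonsing_inv_det h hhdet)
  · calc (g * h⁻¹)ᵀ * J * (g * h⁻¹) = h⁻¹ᵀ * (gᵀ * J * g) * h⁻¹ := by
          rw [transpose_mul]; simp only [mul_assoc]
      _ = h⁻¹ᵀ * (J * (h * h)) * h⁻¹ := by rw [hM, ← hp, sq]
      _ = h⁻¹ᵀ * (J * h) * (h * h⁻¹) := by simp only [mul_assoc]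
      _ = h⁻¹ᵀ * hᵀ * J := by rw [mul_nonsing_inv h hhdet, mul_one, ← hhadj, mul_assoc]
      _ = J := by rw [← transpose_mul, mul_nonsing_inv h hhdet, transpose_one, one_mul]
  · have hinv : (g * h⁻¹)⁻¹ = h * g⁻¹ := by
      rw [Matrix.mul_inv_rev, nonsing_inv_nonsing_inv h hhdet]
    rw [hinv]
    calc g * h⁻¹ * x * (h * g⁻¹) = g * (h⁻¹ * (x * h)) * g⁻¹ := by simp only [mul_assoc]
      _ = g * x * g⁻¹ := by rw [hhx.eq, ← mul_assoc h⁻¹, nonsing_inv_mul h hhdet, one_mul]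

/-- **Lemma 7.1, Cases C and D (`c = 1`): isometries of `J` conjugate under `GL` are conjugate by an
isometry.**  `K` algebraically closed with `2 ≠ 0`, `Jᵀ = ε J` (`ε² = 1`, i.e. `J` symmetric — `O(J)`,
Case D — or alternating — `Sp(J)`, Case C), `det J` a unit; if `xᵀ J x = J = yᵀ J y` and `g x = y g` with
`g` invertible, then `k x = y k` for some isometry `k` (`kᵀ J k = J`, `det k` a unit).
[cite: Kottwitz1992, §7 Lemma 7.1 p. 395] -/
theorem exists_isometry_conj_of_conj [IsAlgClosed K] (h2 : (2 : K) ≠ 0) {J : Matrix n n K}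
    (hJ : IsUnit J.det) {ε : K} (hε : ε * ε = 1) (hJt : Jᵀ = ε • J) {x y g : Matrix n n K}
    (hx : xᵀ * J * x = J) (hy : yᵀ * J * y = J) (hg : IsUnit g.det) (hxy : g * x = y * g) :
    ∃ k : Matrix n n K, IsUnit k.det ∧ kᵀ * J * k = J ∧ k * x = y * k := by
  obtain ⟨k, hk, hkJ, hkx⟩ :=
    exists_isometry_conj_eq_conj_of_commute h2 hJ hε hJt hg (commute_of_isometry_conj hJ hx hy hxy)
  refine ⟨k, hk, hkJ, ?_⟩
  have hy' : g * x * g⁻¹ = y := by rw [hxy, mul_assoc, mul_nonsing_inv g hg, mul_one]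
  rw [hy'] at hkx
  calc k * x = k * x * (k⁻¹ * k) := by rw [nonsing_inv_mul k hk, mul_one]
    _ = y * k := by rw [← mul_assoc, hkx]

/-- **Lemma 7.1, Cases C and D, as an equivalence**: two isometries of `J` are conjugate by an isometry
iff they are conjugate by an invertible matrix. [cite: Kottwitz1992, §7 Lemma 7.1 p. 395] -/
theorem exists_isometry_conj_iff [IsAlgClosed K] (h2 : (2 : K) ≠ 0) {J : Matrix n n K}
    (hJ : IsUnit J.det) {ε : K} (hε : ε * ε = 1) (hJt : Jᵀ = ε • J) {x y : Matrix n n K}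
    (hx : xᵀ * J * x = J) (hy : yᵀ * J * y = J) :
    (∃ k : Matrix n n K, IsUnit k.det ∧ kᵀ * J * k = J ∧ k * x = y * k) ↔
      ∃ g : Matrix n n K, IsUnit g.det ∧ g * x = y * g :=
  ⟨fun ⟨k, hk, _, hkx⟩ => ⟨k, hk, hkx⟩,
    fun ⟨_, hg, hxy⟩ => exists_isometry_conj_of_conj h2 hJ hε hJt hx hy hg hxy⟩

/-- **Lemma 7.1, Cases C and D, inside `GL n K`**: for `x, y ∈ G₁(K) = {k ∈ GL_n(K) : kᵀ J k = J}`
(the tree's `unitaryGroupOfForm (RingHom.id K) J`), `k x k⁻¹ = y` for some `k ∈ G₁(K)` iff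
`g x g⁻¹ = y` for some `g ∈ GL_n(K)`. [cite: Kottwitz1992, §7 Lemma 7.1 p. 395] -/
theorem exists_gl_isometry_conj_iff [IsAlgClosed K] (h2 : (2 : K) ≠ 0) {J : Matrix n n K}
    (hJ : IsUnit J.det) {ε : K} (hε : ε * ε = 1) (hJt : Jᵀ = ε • J) {x y : GL n K}
    (hx : (x : Matrix n n K)ᵀ * J * x = J) (hy : (y : Matrix n n K)ᵀ * J * y = J) :
    (∃ k : GL n K, (k : Matrix n n K)ᵀ * J * k = J ∧ k * x * k⁻¹ = y) ↔
      ∃ g : GL n K, g * x * g⁻¹ = y := by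
  constructor
  · rintro ⟨k, -, hk⟩
    exact ⟨k, hk⟩
  · rintro ⟨g, hg⟩
    have hxy : (g : Matrix n n K) * x = y * g := by
      rw [← Units.val_mul, ← Units.val_mul, mul_inv_eq_iff_eq_mul.mp hg]
    obtain ⟨k, hk, hkJ, hkx⟩ :=
      exists_isometry_conj_of_conj h2 hJ hε hJt hx hy (Matrix.isUnits_det_units g) hxy
    have hku : IsUnit k := (Matrix.isUnit_iff_isUnit_det k).mpr hk
    refine ⟨hku.unit, by rw [hku.unit_spec]; exact hkJ, ?_⟩
    rw [mul_inv_eq_iff_eq_mul]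
    ext1
    rw [Units.val_mul, Units.val_mul, hku.unit_spec, hkx]

/-- **Lie-algebra version** (the same square-root argument): if `Xᵀ J = −J X`, `Yᵀ J = −J Y`
(`X, Y ∈ sp(J)` resp. `so(J)`) and `g X = Y g` with `g` invertible, then `k X = Y k` for some isometry `k`
of `J`. [cite: Kottwitz1992, §7 Lemma 7.1 p. 395] -/
theorem exists_isometry_conj_of_conj_lie [IsAlgClosed K] (h2 : (2 : K) ≠ 0) {J : Matrix n n K}
    (hJ : IsUnit J.det) {ε : K} (hε : ε * ε = 1) (hJt : Jᵀ = ε • J) {X Y g : Matrix n n K}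
    (hX : Xᵀ * J = -(J * X)) (hY : Yᵀ * J = -(J * Y)) (hg : IsUnit g.det) (hXY : g * X = Y * g) :
    ∃ k : Matrix n n K, IsUnit k.det ∧ kᵀ * J * k = J ∧ k * X = Y * k := by
  obtain ⟨k, hk, hkJ, hkx⟩ :=
    exists_isometry_conj_eq_conj_of_commute h2 hJ hε hJt hg (commute_of_skewAdjoint_conj hJ hX hY hXY)
  refine ⟨k, hk, hkJ, ?_⟩
  have hY' : g * X * g⁻¹ = Y := by rw [hXY, mul_assoc, mul_nonsing_inv g hg, mul_one]
  rw [hY'] at hkx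
  calc k * X = k * X * (k⁻¹ * k) := by rw [nonsing_inv_mul k hk, mul_one]
    _ = Y * k := by rw [← mul_assoc, hkx]

/-- **Case C for Mathlib's symplectic group**: over an algebraically closed field with `2 ≠ 0`, two
symplectic matrices (`xᵀ 𝕁 x = 𝕁`, `𝕁 = Matrix.J l K`) are conjugate in `Sp_{2l}(K)` iff they are
conjugate in `GL_{2l}(K)`. [cite: Kottwitz1992, §7 Lemma 7.1 p. 395] -/
theorem symplecticGroup_exists_conj_iff [IsAlgClosed K] (h2 : (2 : K) ≠ 0) {l : Type*} [Fintype l]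
    [DecidableEq l] {x y : Matrix (l ⊕ l) (l ⊕ l) K} (hx : x ∈ Matrix.symplecticGroup l K)
    (hy : y ∈ Matrix.symplecticGroup l K) :
    (∃ k ∈ Matrix.symplecticGroup l K, k * x = y * k) ↔
      ∃ g : Matrix (l ⊕ l) (l ⊕ l) K, IsUnit g.det ∧ g * x = y * g := by
  have hJ : IsUnit (Matrix.J l K).det := Matrix.isUnit_det_J l K
  have hJt : (Matrix.J l K)ᵀ = (-1 : K) • Matrix.J l K := by rw [Matrix.J_transpose, neg_one_smul]
  have hε : (-1 : K) * -1 = 1 := by ring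
  rw [SymplecticGroup.mem_iff'] at hx hy
  constructor
  · rintro ⟨k, hk, hkx⟩
    rw [SymplecticGroup.mem_iff'] at hk
    exact ⟨k, isUnit_det_of_isometry hJ hk, hkx⟩
  · rintro ⟨g, hg, hxy⟩
    obtain ⟨k, _, hkJ, hkx⟩ := exists_isometry_conj_of_conj h2 hJ hε hJt hx hy hg hxy
    exact ⟨k, (SymplecticGroup.mem_iff').mpr hkJ, hkx⟩

/-- **Case D for the standard form `J = 1`**: over an algebraically closed field with `2 ≠ 0`, two
orthogonal matrices (`xᵀ x = 1`) are conjugate by an orthogonal matrix iff they are conjugate by an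
invertible one. [cite: Kottwitz1992, §7 Lemma 7.1 p. 395] -/
theorem orthogonal_exists_conj_iff [IsAlgClosed K] (h2 : (2 : K) ≠ 0) {x y : Matrix n n K}
    (hx : xᵀ * x = 1) (hy : yᵀ * y = 1) :
    (∃ k : Matrix n n K, kᵀ * k = 1 ∧ k * x = y * k) ↔
      ∃ g : Matrix n n K, IsUnit g.det ∧ g * x = y * g := by
  have hJ : IsUnit (1 : Matrix n n K).det := by rw [det_one]; exact isUnit_one
  have hJt : (1 : Matrix n n K)ᵀ = (1 : K) • (1 : Matrix n n K) := by rw [transpose_one, one_smul]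
  have hx' : xᵀ * 1 * x = 1 := by rw [mul_one, hx]
  have hy' : yᵀ * 1 * y = 1 := by rw [mul_one, hy]
  constructor
  · rintro ⟨k, hk, hkx⟩
    exact ⟨k, isUnit_det_of_isometry hJ (by rw [mul_one, hk]), hkx⟩
  · rintro ⟨g, hg, hxy⟩
    obtain ⟨k, _, hkJ, hkx⟩ := exists_isometry_conj_of_conj h2 hJ (one_mul (1 : K)) hJt hx' hy' hg hxy
    exact ⟨k, by rwa [mul_one] at hkJ, hkx⟩

end Isometry

/-! ## §3 Similitudes: Lemma 7.1 with the multiplier `c` -/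

section Similitude

variable {n : Type*} [Fintype n] [DecidableEq n]

/-- **The multiplier is a conjugation invariant** (the "only if" of Lemma 7.1): if `k` is a similitude
(`kᵀ J k = e J`, `det k` a unit), `x` a similitude of multiplier `c` and `k x = y k`, then `y` is a
similitude of multiplier `c`. [cite: Kottwitz1992, §7 Lemma 7.1 p. 395] -/
theorem multiplier_of_conj {J x y k : Matrix n n K} {c e : K} (hk : IsUnit k.det)
    (hke : kᵀ * J * k = e • J) (hx : xᵀ * J * x = c • J) (hxy : k * x = y * k) :
    yᵀ * J * y = c • J := by
  have hku : IsUnit kᵀ := (Matrix.isUnit_iff_isUnit_det _).mpr (by rw [det_transpose]; exact hk)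
  have hku' : IsUnit k := (Matrix.isUnit_iff_isUnit_det _).mpr hk
  -- `kᵀ (yᵀ J y) k = (k x)ᵀ J (k x) = e c J = kᵀ (c J) k`
  have key : kᵀ * (yᵀ * J * y) * k = kᵀ * (c • J) * k := by
    calc kᵀ * (yᵀ * J * y) * k = (y * k)ᵀ * J * (y * k) := by rw [transpose_mul]; simp only [mul_assoc]
      _ = (k * x)ᵀ * J * (k * x) := by rw [hxy]
      _ = xᵀ * (kᵀ * J * k) * x := by rw [transpose_mul]; simp only [mul_assoc]
      _ = (e * c) • J := by rw [hke, Matrix.mul_smul, Matrix.smul_mul, hx, smul_smul]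
      _ = kᵀ * (c • J) * k := by rw [Matrix.mul_smul, Matrix.smul_mul, hke, smul_smul, mul_comm c e]
  have key' : kᵀ * (yᵀ * J * y * k) = kᵀ * (c • J * k) := by simpa only [mul_assoc] using key
  exact hku'.mul_left_injective (hku.mul_right_injective key')

omit [Fintype n] [DecidableEq n] in
/-- `c J = d J ⇒ c = d` for `J ≠ 0`. [folklore] -/
private theorem eq_of_smul_eq_smul {J : Matrix n n K} (hJ0 : J ≠ 0) {c d : K} (h : c • J = d • J) :
    c = d :=
  smul_left_injective K hJ0 h

/-- A matrix with unit determinant over a nonempty index type is nonzero. [folklore] -/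
private theorem ne_zero_of_isUnit_det [Nonempty n] {J : Matrix n n K}
    (hJ : IsUnit J.det) : J ≠ 0 := by
  rintro rfl
  rw [det_zero] at hJ
  exact not_isUnit_zero hJ

/-- **«Modifying `x, y` by the same scalar, we may assume that `c(x) = c(y) = 1`»**: over an algebraically
closed field with `2 ≠ 0`, two similitudes of `J` (`Jᵀ = ε J`, `ε² = 1`, `det J` a unit) with the SAME
nonzero multiplier `c` which are conjugate under `GL` are conjugate by an ISOMETRY of `J` (rescale by
`√c ∈ K` and apply the isometry case). [cite: Kottwitz1992, §7 Lemma 7.1 p. 395] -/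
theorem exists_isometry_conj_of_multiplier_eq [IsAlgClosed K] (h2 : (2 : K) ≠ 0) {J : Matrix n n K}
    (hJ : IsUnit J.det) {ε : K} (hε : ε * ε = 1) (hJt : Jᵀ = ε • J) {x y g : Matrix n n K} {c : K}
    (hc : c ≠ 0) (hx : xᵀ * J * x = c • J) (hy : yᵀ * J * y = c • J) (hg : IsUnit g.det)
    (hxy : g * x = y * g) :
    ∃ k : Matrix n n K, IsUnit k.det ∧ kᵀ * J * k = J ∧ k * x = y * k := by
  obtain ⟨r, hr⟩ := IsAlgClosed.exists_pow_nat_eq c two_pos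
  have hr0 : r ≠ 0 := by rintro rfl; exact hc (by rw [← hr, zero_pow two_ne_zero])
  have hrr : r⁻¹ * r⁻¹ * c = 1 := by
    rw [← hr]; field_simp
  have hscale : ∀ {z : Matrix n n K}, zᵀ * J * z = c • J → (r⁻¹ • z)ᵀ * J * (r⁻¹ • z) = J := by
    intro z hz
    rw [transpose_smul, Matrix.smul_mul, Matrix.smul_mul, Matrix.mul_smul, hz, smul_smul, smul_smul,
      hrr, one_smul]
  have hxy' : g * (r⁻¹ • x) = (r⁻¹ • y) * g := by rw [Matrix.mul_smul, Matrix.smul_mul, hxy]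
  obtain ⟨k, hk, hkJ, hkx⟩ :=
    exists_isometry_conj_of_conj h2 hJ hε hJt (hscale hx) (hscale hy) hg hxy'
  refine ⟨k, hk, hkJ, ?_⟩
  rw [Matrix.mul_smul, Matrix.smul_mul] at hkx
  exact smul_right_injective (Matrix n n K) (inv_ne_zero hr0) hkx

/-- **Lemma 7.1 for one factor of type C or D** (`K` algebraically closed, `2 ≠ 0`, `n` nonempty,
`Jᵀ = ε J` with `ε² = 1`, `det J` a unit): two similitudes `x, y` of `J` with multipliers
`c(x) = c ≠ 0`, `c(y) = d` are conjugate by a similitude of `J` iff `c(x) = c(y)` and they are conjugate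
under `GL`. [cite: Kottwitz1992, §7 Lemma 7.1 p. 395] -/
theorem exists_similitude_conj_iff [IsAlgClosed K] [Nonempty n] (h2 : (2 : K) ≠ 0) {J : Matrix n n K}
    (hJ : IsUnit J.det) {ε : K} (hε : ε * ε = 1) (hJt : Jᵀ = ε • J) {x y : Matrix n n K} {c d : K}
    (hc : c ≠ 0) (hx : xᵀ * J * x = c • J) (hy : yᵀ * J * y = d • J) :
    (∃ (k : Matrix n n K) (e : K), IsUnit k.det ∧ kᵀ * J * k = e • J ∧ k * x = y * k) ↔
      (c = d ∧ ∃ g : Matrix n n K, IsUnit g.det ∧ g * x = y * g) := by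
  constructor
  · rintro ⟨k, e, hk, hke, hkx⟩
    refine ⟨?_, k, hk, hkx⟩
    have hy' : yᵀ * J * y = c • J := multiplier_of_conj hk hke hx hkx
    exact eq_of_smul_eq_smul (ne_zero_of_isUnit_det hJ) (hy'.symm.trans hy)
  · rintro ⟨rfl, g, hg, hxy⟩
    obtain ⟨k, hk, hkJ, hkx⟩ := exists_isometry_conj_of_multiplier_eq h2 hJ hε hJt hc hx hy hg hxy
    exact ⟨k, 1, hk, by rw [hkJ, one_smul], hkx⟩

/-- **«Case A is trivial»**: for the diagonal embedding `M ↪ M × M`, `x ↦ (x, x)`, two elements `x, y`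
of a monoid `M` are conjugate iff `(x, x)`, `(y, y)` are conjugate in `M × M`.
[cite: Kottwitz1992, §7 Lemma 7.1 p. 395] -/
theorem isConj_prod_diag_iff {M : Type*} [Monoid M] {x y : M} :
    IsConj ((x, x) : M × M) (y, y) ↔ IsConj x y := by
  constructor
  · rintro ⟨c, hc⟩
    refine ⟨Units.map (MonoidHom.fst M M) c, ?_⟩
    have h := congrArg Prod.fst hc.eq
    exact h
  · rintro ⟨c, hc⟩
    refine ⟨Units.map ((MonoidHom.id M).prod (MonoidHom.id M)) c, ?_⟩
    simp only [SemiconjBy, Units.coe_map, MonoidHom.prod_apply, MonoidHom.id_apply, Prod.mk_mul_mk,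
      hc.eq]

end Similitude

end Literature.LinearAlgebra.Matrix.IsometryConjugacy
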